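import Mathlib
import Summits.MatrixMultiplication.MatrixMultiplication.Theorems.FidelityWitnessesRankTwoAdditivityNorms

/-!
# `FidelityWitnesses.RankTwoAdditivity` (stmt-MatrixMultiplication-4964) — degenerate cases of the core inequality

The core four-matrix inequality CORE (see the Reduction and Duality files) in the degenerate cases:
a zero factor (`core_zero_u₁`, `core_zero_v₁`), and the collinear cases `X₂ = c • X₁` (`core_collinear_u`) and
`Y₂ = c • Y₁` (`core_collinear_v`, by transposition), where CORE reduces to the submultiplicativity bound
`‖X W‖ ≤ ‖X‖‖W‖` for `W = ‖Y₁‖² Y₂ − ⟨Y₁,Y₂⟩ Y₁` (`collinear_aux`).  `collinear_of_normsq_eq` is the equality case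
of Cauchy–Schwarz.  Together with `core_of_certificate` this leaves only the strict (non-collinear) case.
Supports item `stmt-MatrixMultiplication-4964`; no definitions are introduced.
-/

namespace Summit.MatrixMultiplication.MatrixMultiplication.Theorems.RankTwoAdditivity

open scoped BigOperators ComplexConjugate

/-- Collinear case `X₂ = c • X₁` of CORE, reduced form: for `A = X₁Y₁`, `A' = X₁Y₂`,
`nv₁·(nv₂‖A‖² + nv₁‖A'‖² − 2Re(ȳ⟨A,A'⟩)) ≤ 2‖X₁‖² nv₁ (nv₁nv₂ − |y|²)`. [folklore] -/
theorem collinear_aux {ι κ μ : Type*} [Fintype ι] [Fintype κ] [Fintype μ]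
    (u : ι × κ → ℂ) (v₁ v₂ : κ × μ → ℂ) (A A' : ι × μ → ℂ)
    (hA : ∀ a, A a = ∑ m, u (a.1, m) * v₁ (m, a.2))
    (hA' : ∀ a, A' a = ∑ m, u (a.1, m) * v₂ (m, a.2)) :
    (∑ c, ‖v₁ c‖ ^ 2) * ((∑ c, ‖v₂ c‖ ^ 2) * (∑ a, ‖A a‖ ^ 2)
        + (∑ c, ‖v₁ c‖ ^ 2) * (∑ a, ‖A' a‖ ^ 2)
        - 2 * (conj (∑ c, conj (v₁ c) * v₂ c) * ∑ a, conj (A a) * A' a).re)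
      ≤ 2 * (∑ b, ‖u b‖ ^ 2) * (∑ c, ‖v₁ c‖ ^ 2)
          * ((∑ c, ‖v₁ c‖ ^ 2) * (∑ c, ‖v₂ c‖ ^ 2) - ‖∑ c, conj (v₁ c) * v₂ c‖ ^ 2) := by
  set nv₁ : ℝ := ∑ c, ‖v₁ c‖ ^ 2 with hnv₁
  set nv₂ : ℝ := ∑ c, ‖v₂ c‖ ^ 2 with hnv₂
  set nu : ℝ := ∑ b, ‖u b‖ ^ 2 with hnu
  set y : ℂ := ∑ c, conj (v₁ c) * v₂ c with hy
  -- the combination W = nv₁ • Y₂ − y • Y₁ and its product with X₁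
  set w : κ × μ → ℂ := fun c => (nv₁ : ℂ) * v₂ c - y * v₁ c with hw
  set D : ι × μ → ℂ := fun a => (nv₁ : ℂ) * A' a - y * A a with hD
  have hDprod : ∀ a, D a = ∑ m, u (a.1, m) * w (m, a.2) := by
    intro a
    simp only [hD, hw, hA a, hA' a, Finset.mul_sum, ← Finset.sum_sub_distrib]
    exact Finset.sum_congr rfl fun m _ => by ring
  -- ‖W‖² = nv₁ (nv₁ nv₂ − |y|²)
  have hy2 : ‖y‖ ^ 2 ≤ nv₁ * nv₂ := by rw [hy, hnv₁, hnv₂]; exact norm_sq_hsum_le v₁ v₂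
  have hwnorm : (∑ c, ‖w c‖ ^ 2) = nv₁ * (nv₁ * nv₂ - ‖y‖ ^ 2) := by
    have h := norm_sq_add_sum (fun c => (nv₁ : ℂ) * v₂ c) (fun c => -(y * v₁ c))
    have e1 : (∑ c, ‖(nv₁ : ℂ) * v₂ c‖ ^ 2) = nv₁ ^ 2 * nv₂ := by
      rw [hnv₂, Finset.mul_sum]
      refine Finset.sum_congr rfl fun c _ => ?_
      have : 0 ≤ nv₁ := by rw [hnv₁]; exact Finset.sum_nonneg fun _ _ => by positivity
      rw [norm_mul, Complex.norm_real, Real.norm_of_nonneg this, mul_pow]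
    have e2 : (∑ c, ‖-(y * v₁ c)‖ ^ 2) = ‖y‖ ^ 2 * nv₁ := by
      rw [hnv₁, Finset.mul_sum]
      refine Finset.sum_congr rfl fun c _ => ?_
      rw [norm_neg, norm_mul, mul_pow]
    have e3 : (∑ c, conj ((nv₁ : ℂ) * v₂ c) * -(y * v₁ c)) = -((nv₁ : ℂ) * y * conj y) := by
      have hyc : conj y = ∑ c, conj (v₂ c) * v₁ c := by
        rw [hy, map_sum]; exact Finset.sum_congr rfl fun c _ => by rw [map_mul, Complex.conj_conj, mul_comm]
      rw [hyc, Finset.mul_sum, ← Finset.sum_neg_distrib]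
      refine Finset.sum_congr rfl fun c _ => ?_
      simp only [map_mul, Complex.conj_ofReal]; ring
    have hw' : (∑ c, ‖w c‖ ^ 2) = ∑ c, ‖(nv₁ : ℂ) * v₂ c + -(y * v₁ c)‖ ^ 2 :=
      Finset.sum_congr rfl fun c _ => by simp only [hw, sub_eq_add_neg]
    rw [hw', h, e1, e2, e3, Complex.neg_re]
    have : ((nv₁ : ℂ) * y * conj y).re = nv₁ * ‖y‖ ^ 2 := by
      rw [mul_assoc, Complex.mul_conj, ← Complex.ofReal_mul, Complex.ofReal_re, Complex.normSq_eq_norm_sq]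
    rw [this]; ring
  -- ‖D‖² ≤ ‖X₁‖² ‖W‖²  and  ‖A‖² ≤ ‖X₁‖² nv₁
  have hDle : (∑ a, ‖D a‖ ^ 2) ≤ nu * (nv₁ * (nv₁ * nv₂ - ‖y‖ ^ 2)) := by
    rw [← hwnorm, hnu]; exact norm_sq_mul_le u w D hDprod
  have hAle : (∑ a, ‖A a‖ ^ 2) ≤ nu * nv₁ := by rw [hnu, hnv₁]; exact norm_sq_mul_le u v₁ A hA
  -- ‖D‖² = nv₁² ‖A'‖² + |y|² ‖A‖² − 2 nv₁ Re(ȳ ⟨A, A'⟩)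
  have hDexp : (∑ a, ‖D a‖ ^ 2) = nv₁ ^ 2 * (∑ a, ‖A' a‖ ^ 2) + ‖y‖ ^ 2 * (∑ a, ‖A a‖ ^ 2)
      - 2 * nv₁ * (conj y * ∑ a, conj (A a) * A' a).re := by
    have h := norm_sq_add_sum (fun a => (nv₁ : ℂ) * A' a) (fun a => -(y * A a))
    have e1 : (∑ a, ‖(nv₁ : ℂ) * A' a‖ ^ 2) = nv₁ ^ 2 * ∑ a, ‖A' a‖ ^ 2 := by
      rw [Finset.mul_sum]
      refine Finset.sum_congr rfl fun a _ => ?_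
      have : 0 ≤ nv₁ := by rw [hnv₁]; exact Finset.sum_nonneg fun _ _ => by positivity
      rw [norm_mul, Complex.norm_real, Real.norm_of_nonneg this, mul_pow]
    have e2 : (∑ a, ‖-(y * A a)‖ ^ 2) = ‖y‖ ^ 2 * ∑ a, ‖A a‖ ^ 2 := by
      rw [Finset.mul_sum]
      refine Finset.sum_congr rfl fun a _ => ?_
      rw [norm_neg, norm_mul, mul_pow]
    have e3 : (∑ a, conj ((nv₁ : ℂ) * A' a) * -(y * A a)) = -((nv₁ : ℂ) * (y * ∑ a, conj (A' a) * A a)) := by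
      rw [Finset.mul_sum, Finset.mul_sum, ← Finset.sum_neg_distrib]
      refine Finset.sum_congr rfl fun a _ => ?_
      simp only [map_mul, Complex.conj_ofReal]; ring
    have e4 : (y * ∑ a, conj (A' a) * A a).re = (conj y * ∑ a, conj (A a) * A' a).re := by
      have hS : (∑ a, conj (A a) * A' a) = conj (∑ a, conj (A' a) * A a) := by
        rw [map_sum]; exact Finset.sum_congr rfl fun a _ => by rw [map_mul, Complex.conj_conj, mul_comm]
      rw [hS, ← map_mul, Complex.conj_re]
    have hD' : (∑ a, ‖D a‖ ^ 2) = ∑ a, ‖(nv₁ : ℂ) * A' a + -(y * A a)‖ ^ 2 :=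
      Finset.sum_congr rfl fun a _ => by simp only [hD, sub_eq_add_neg]
    rw [hD', h, e1, e2, e3, Complex.neg_re, Complex.re_ofReal_mul, e4]; ring
  -- assemble: nv₁ * LHS = ‖D‖² + (nv₁nv₂ − |y|²)‖A‖²
  have hnv₁0 : 0 ≤ nv₁ := by rw [hnv₁]; exact Finset.sum_nonneg fun _ _ => by positivity
  have hs0 : 0 ≤ nv₁ * nv₂ - ‖y‖ ^ 2 := by linarith
  have key : nv₁ * (nv₂ * (∑ a, ‖A a‖ ^ 2) + nv₁ * (∑ a, ‖A' a‖ ^ 2)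
      - 2 * (conj y * ∑ a, conj (A a) * A' a).re)
      = (∑ a, ‖D a‖ ^ 2) + (nv₁ * nv₂ - ‖y‖ ^ 2) * (∑ a, ‖A a‖ ^ 2) := by
    rw [hDexp]; ring
  rw [key]
  nlinarith [mul_le_mul_of_nonneg_left hAle hs0]

/-- Zero case of CORE: if `X₁ = 0` then both sides vanish appropriately. -/
theorem core_zero_u₁ {ι κ μ : Type*} [Fintype ι] [Fintype κ] [Fintype μ]
    (u₁ u₂ : ι × κ → ℂ) (v₁ v₂ : κ × μ → ℂ) (A B : ι × μ → ℂ)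
    (hA : ∀ a, A a = ∑ m, u₁ (a.1, m) * v₁ (m, a.2))
    (h0 : ∀ b, u₁ b = 0) :
    ((∑ b, ‖u₁ b‖ ^ 2) * ∑ c, ‖v₁ c‖ ^ 2) * (∑ a, ‖B a‖ ^ 2)
      + ((∑ b, ‖u₂ b‖ ^ 2) * ∑ c, ‖v₂ c‖ ^ 2) * (∑ a, ‖A a‖ ^ 2)
      + 2 * ‖(∑ b, conj (u₁ b) * u₂ b) * ∑ c, conj (v₁ c) * v₂ c‖ ^ 2
    ≤ 2 * ((∑ b, ‖u₁ b‖ ^ 2) * ∑ c, ‖v₁ c‖ ^ 2) * ((∑ b, ‖u₂ b‖ ^ 2) * ∑ c, ‖v₂ c‖ ^ 2)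
      + 2 * (conj ((∑ b, conj (u₁ b) * u₂ b) * ∑ c, conj (v₁ c) * v₂ c)
              * ∑ a, conj (A a) * B a).re := by
  have hA0 : ∀ a, A a = 0 := fun a => by rw [hA]; exact Finset.sum_eq_zero fun m _ => by rw [h0, zero_mul]
  simp [h0, hA0]

/-- Zero case of CORE: if `Y₁ = 0`. -/
theorem core_zero_v₁ {ι κ μ : Type*} [Fintype ι] [Fintype κ] [Fintype μ]
    (u₁ u₂ : ι × κ → ℂ) (v₁ v₂ : κ × μ → ℂ) (A B : ι × μ → ℂ)
    (hA : ∀ a, A a = ∑ m, u₁ (a.1, m) * v₁ (m, a.2))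
    (h0 : ∀ c, v₁ c = 0) :
    ((∑ b, ‖u₁ b‖ ^ 2) * ∑ c, ‖v₁ c‖ ^ 2) * (∑ a, ‖B a‖ ^ 2)
      + ((∑ b, ‖u₂ b‖ ^ 2) * ∑ c, ‖v₂ c‖ ^ 2) * (∑ a, ‖A a‖ ^ 2)
      + 2 * ‖(∑ b, conj (u₁ b) * u₂ b) * ∑ c, conj (v₁ c) * v₂ c‖ ^ 2
    ≤ 2 * ((∑ b, ‖u₁ b‖ ^ 2) * ∑ c, ‖v₁ c‖ ^ 2) * ((∑ b, ‖u₂ b‖ ^ 2) * ∑ c, ‖v₂ c‖ ^ 2)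
      + 2 * (conj ((∑ b, conj (u₁ b) * u₂ b) * ∑ c, conj (v₁ c) * v₂ c)
              * ∑ a, conj (A a) * B a).re := by
  have hA0 : ∀ a, A a = 0 := fun a => by rw [hA]; exact Finset.sum_eq_zero fun m _ => by rw [h0, mul_zero]
  simp [h0, hA0]

/-- Collinear case `X₂ = c • X₁` of CORE. -/
theorem core_collinear_u {ι κ μ : Type*} [Fintype ι] [Fintype κ] [Fintype μ]
    (u₁ u₂ : ι × κ → ℂ) (v₁ v₂ : κ × μ → ℂ) (A B : ι × μ → ℂ)
    (hA : ∀ a, A a = ∑ m, u₁ (a.1, m) * v₁ (m, a.2))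
    (hB : ∀ a, B a = ∑ m, u₂ (a.1, m) * v₂ (m, a.2))
    (c₀ : ℂ) (hcol : ∀ b, u₂ b = c₀ * u₁ b) (hv₁ : 0 < ∑ c, ‖v₁ c‖ ^ 2) :
    ((∑ b, ‖u₁ b‖ ^ 2) * ∑ c, ‖v₁ c‖ ^ 2) * (∑ a, ‖B a‖ ^ 2)
      + ((∑ b, ‖u₂ b‖ ^ 2) * ∑ c, ‖v₂ c‖ ^ 2) * (∑ a, ‖A a‖ ^ 2)
      + 2 * ‖(∑ b, conj (u₁ b) * u₂ b) * ∑ c, conj (v₁ c) * v₂ c‖ ^ 2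
    ≤ 2 * ((∑ b, ‖u₁ b‖ ^ 2) * ∑ c, ‖v₁ c‖ ^ 2) * ((∑ b, ‖u₂ b‖ ^ 2) * ∑ c, ‖v₂ c‖ ^ 2)
      + 2 * (conj ((∑ b, conj (u₁ b) * u₂ b) * ∑ c, conj (v₁ c) * v₂ c)
              * ∑ a, conj (A a) * B a).re := by
  -- A' = X₁ Y₂, B = c₀ A'
  set A' : ι × μ → ℂ := fun a => ∑ m, u₁ (a.1, m) * v₂ (m, a.2) with hA'def
  have hA' : ∀ a, A' a = ∑ m, u₁ (a.1, m) * v₂ (m, a.2) := fun a => rfl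
  have hBc : ∀ a, B a = c₀ * A' a := by
    intro a; rw [hB, hA', Finset.mul_sum]
    exact Finset.sum_congr rfl fun m _ => by rw [hcol]; ring
  set nu₁ : ℝ := ∑ b, ‖u₁ b‖ ^ 2 with hnu₁
  set nv₁ : ℝ := ∑ c, ‖v₁ c‖ ^ 2 with hnv₁
  set nv₂ : ℝ := ∑ c, ‖v₂ c‖ ^ 2 with hnv₂
  set y : ℂ := ∑ c, conj (v₁ c) * v₂ c with hy
  set S : ℂ := ∑ a, conj (A a) * A' a with hS
  -- the substitutions
  have hnu₂ : (∑ b, ‖u₂ b‖ ^ 2) = ‖c₀‖ ^ 2 * nu₁ := by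
    rw [hnu₁, Finset.mul_sum]; exact Finset.sum_congr rfl fun b _ => by rw [hcol, norm_mul, mul_pow]
  have hx : (∑ b, conj (u₁ b) * u₂ b) = c₀ * nu₁ := by
    rw [hnu₁]; push_cast; rw [Finset.mul_sum]
    refine Finset.sum_congr rfl fun b _ => ?_
    rw [hcol, ← Complex.conj_mul']; ring
  have hBn : (∑ a, ‖B a‖ ^ 2) = ‖c₀‖ ^ 2 * ∑ a, ‖A' a‖ ^ 2 := by
    rw [Finset.mul_sum]; exact Finset.sum_congr rfl fun a _ => by rw [hBc, norm_mul, mul_pow]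
  have hq : (∑ a, conj (A a) * B a) = c₀ * S := by
    rw [hS, Finset.mul_sum]; exact Finset.sum_congr rfl fun a _ => by rw [hBc]; ring
  have haux := collinear_aux u₁ v₁ v₂ A A' hA hA'
  rw [hnu₂, hx, hBn, hq]
  -- reduce to the bracket inequality
  have hbr : nv₂ * (∑ a, ‖A a‖ ^ 2) + nv₁ * (∑ a, ‖A' a‖ ^ 2) - 2 * (conj y * S).re
      ≤ 2 * nu₁ * (nv₁ * nv₂ - ‖y‖ ^ 2) := by
    have h2 : nv₁ * (nv₂ * (∑ a, ‖A a‖ ^ 2) + nv₁ * (∑ a, ‖A' a‖ ^ 2) - 2 * (conj y * S).re)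
        ≤ nv₁ * (2 * nu₁ * (nv₁ * nv₂ - ‖y‖ ^ 2)) := by nlinarith [haux]
    exact le_of_mul_le_mul_left h2 hv₁
  -- expand the norms / real parts of the substituted expressions
  have e1 : ‖c₀ * (nu₁ : ℂ) * y‖ ^ 2 = ‖c₀‖ ^ 2 * nu₁ ^ 2 * ‖y‖ ^ 2 := by
    have h0 : 0 ≤ nu₁ := by rw [hnu₁]; exact Finset.sum_nonneg fun _ _ => by positivity
    rw [norm_mul, norm_mul, Complex.norm_real, Real.norm_of_nonneg h0]; ring
  have e2 : (conj (c₀ * (nu₁ : ℂ) * y) * (c₀ * S)).re = ‖c₀‖ ^ 2 * nu₁ * (conj y * S).re := by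
    have : conj (c₀ * (nu₁ : ℂ) * y) * (c₀ * S) = ((‖c₀‖ ^ 2 * nu₁ : ℝ) : ℂ) * (conj y * S) := by
      simp only [map_mul, Complex.conj_ofReal]; push_cast; rw [← Complex.conj_mul']; ring
    rw [this, Complex.re_ofReal_mul]
  rw [e1, e2]
  have hc : 0 ≤ ‖c₀‖ ^ 2 * nu₁ := by
    have h0 : 0 ≤ nu₁ := by rw [hnu₁]; exact Finset.sum_nonneg fun _ _ => by positivity
    positivity
  nlinarith [mul_le_mul_of_nonneg_left hbr hc]

/-- Equality in Cauchy–Schwarz forces collinearity: `|⟨X₁,X₂⟩|² = ‖X₁‖²‖X₂‖²` and `X₁ ≠ 0` give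
`X₂ = (⟨X₁,X₂⟩/‖X₁‖²) • X₁`. -/
theorem collinear_of_normsq_eq {α : Type*} [Fintype α] (u₁ u₂ : α → ℂ)
    (h : ‖∑ b, conj (u₁ b) * u₂ b‖ ^ 2 = (∑ b, ‖u₁ b‖ ^ 2) * ∑ b, ‖u₂ b‖ ^ 2)
    (hpos : 0 < ∑ b, ‖u₁ b‖ ^ 2) :
    ∀ b, u₂ b = ((∑ b, conj (u₁ b) * u₂ b) / (∑ b, ‖u₁ b‖ ^ 2 : ℝ)) * u₁ b := by
  set nu₁ : ℝ := ∑ b, ‖u₁ b‖ ^ 2 with hnu₁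
  set nu₂ : ℝ := ∑ b, ‖u₂ b‖ ^ 2 with hnu₂
  set x : ℂ := ∑ b, conj (u₁ b) * u₂ b with hx
  -- ∑ ‖nu₁ u₂ − x u₁‖² = nu₁ (nu₁ nu₂ − |x|²) = 0
  have hsum : (∑ b, ‖(nu₁ : ℂ) * u₂ b + -(x * u₁ b)‖ ^ 2) = nu₁ * (nu₁ * nu₂ - ‖x‖ ^ 2) := by
    rw [norm_sq_add_sum]
    have e1 : (∑ b, ‖(nu₁ : ℂ) * u₂ b‖ ^ 2) = nu₁ ^ 2 * nu₂ := by
      rw [hnu₂, Finset.mul_sum]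
      refine Finset.sum_congr rfl fun b _ => ?_
      rw [norm_mul, Complex.norm_real, Real.norm_of_nonneg hpos.le, mul_pow]
    have e2 : (∑ b, ‖-(x * u₁ b)‖ ^ 2) = ‖x‖ ^ 2 * nu₁ := by
      rw [hnu₁, Finset.mul_sum]
      refine Finset.sum_congr rfl fun b _ => ?_
      rw [norm_neg, norm_mul, mul_pow]
    have e3 : (∑ b, conj ((nu₁ : ℂ) * u₂ b) * -(x * u₁ b)) = -((nu₁ : ℂ) * (x * conj x)) := by
      have hxc : conj x = ∑ b, conj (u₂ b) * u₁ b := by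
        rw [hx, map_sum]; exact Finset.sum_congr rfl fun b _ => by rw [map_mul, Complex.conj_conj, mul_comm]
      rw [hxc, Finset.mul_sum, Finset.mul_sum, ← Finset.sum_neg_distrib]
      refine Finset.sum_congr rfl fun b _ => ?_
      simp only [map_mul, Complex.conj_ofReal]; ring
    rw [e1, e2, e3, Complex.neg_re, Complex.re_ofReal_mul, Complex.mul_conj', ← Complex.ofReal_pow,
      Complex.ofReal_re]
    ring
  have hzero : (∑ b, ‖(nu₁ : ℂ) * u₂ b + -(x * u₁ b)‖ ^ 2) = 0 := by
    rw [hsum, ← h]; ring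
  have hall := (Finset.sum_eq_zero_iff_of_nonneg fun b _ => by positivity).1 hzero
  intro b
  have hb : ‖(nu₁ : ℂ) * u₂ b + -(x * u₁ b)‖ ^ 2 = 0 := hall b (Finset.mem_univ b)
  have hb' : (nu₁ : ℂ) * u₂ b = x * u₁ b := by
    have h2 : ‖(nu₁ : ℂ) * u₂ b + -(x * u₁ b)‖ = 0 := (pow_eq_zero_iff two_ne_zero).1 hb
    linear_combination (norm_eq_zero.1 h2)
  have hnu₁ne : (nu₁ : ℂ) ≠ 0 := by exact_mod_cast hpos.ne'
  field_simp
  linear_combination hb'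

/-- Reindexing a sum over `α × β` through the swap. -/
theorem sum_swap_index {α β : Type*} [Fintype α] [Fintype β] {M : Type*} [AddCommMonoid M]
    (f : α × β → M) : (∑ p : β × α, f (p.2, p.1)) = ∑ q : α × β, f q :=
  Equiv.sum_comp (Equiv.prodComm β α) f

/-- Collinear case `Y₂ = c • Y₁` of CORE (by transposition from `core_collinear_u`). -/
theorem core_collinear_v {ι κ μ : Type*} [Fintype ι] [Fintype κ] [Fintype μ]
    (u₁ u₂ : ι × κ → ℂ) (v₁ v₂ : κ × μ → ℂ) (A B : ι × μ → ℂ)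
    (hA : ∀ a, A a = ∑ m, u₁ (a.1, m) * v₁ (m, a.2))
    (hB : ∀ a, B a = ∑ m, u₂ (a.1, m) * v₂ (m, a.2))
    (c₀ : ℂ) (hcol : ∀ c, v₂ c = c₀ * v₁ c) (hu₁ : 0 < ∑ b, ‖u₁ b‖ ^ 2) :
    ((∑ b, ‖u₁ b‖ ^ 2) * ∑ c, ‖v₁ c‖ ^ 2) * (∑ a, ‖B a‖ ^ 2)
      + ((∑ b, ‖u₂ b‖ ^ 2) * ∑ c, ‖v₂ c‖ ^ 2) * (∑ a, ‖A a‖ ^ 2)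
      + 2 * ‖(∑ b, conj (u₁ b) * u₂ b) * ∑ c, conj (v₁ c) * v₂ c‖ ^ 2
    ≤ 2 * ((∑ b, ‖u₁ b‖ ^ 2) * ∑ c, ‖v₁ c‖ ^ 2) * ((∑ b, ‖u₂ b‖ ^ 2) * ∑ c, ‖v₂ c‖ ^ 2)
      + 2 * (conj ((∑ b, conj (u₁ b) * u₂ b) * ∑ c, conj (v₁ c) * v₂ c)
              * ∑ a, conj (A a) * B a).re := by
  -- transposed data
  have h := core_collinear_u (ι := μ) (κ := κ) (μ := ι)
    (fun p => v₁ (p.2, p.1)) (fun p => v₂ (p.2, p.1)) (fun p => u₁ (p.2, p.1)) (fun p => u₂ (p.2, p.1))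
    (fun p => A (p.2, p.1)) (fun p => B (p.2, p.1))
    (fun p => by rw [hA]; exact Finset.sum_congr rfl fun m _ => mul_comm _ _)
    (fun p => by rw [hB]; exact Finset.sum_congr rfl fun m _ => mul_comm _ _)
    c₀ (fun p => hcol _) (by rw [sum_swap_index (fun b => ‖u₁ b‖ ^ 2)]; exact hu₁)
  rw [sum_swap_index (fun c => ‖v₁ c‖ ^ 2), sum_swap_index (fun c => ‖v₂ c‖ ^ 2),
    sum_swap_index (fun b => ‖u₁ b‖ ^ 2), sum_swap_index (fun b => ‖u₂ b‖ ^ 2),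
    sum_swap_index (fun a => ‖A a‖ ^ 2), sum_swap_index (fun a => ‖B a‖ ^ 2),
    sum_swap_index (fun c => conj (v₁ c) * v₂ c), sum_swap_index (fun b => conj (u₁ b) * u₂ b),
    sum_swap_index (fun a => conj (A a) * B a)] at h
  have e1 : (∑ c, conj (v₁ c) * v₂ c) * (∑ b, conj (u₁ b) * u₂ b)
      = (∑ b, conj (u₁ b) * u₂ b) * ∑ c, conj (v₁ c) * v₂ c := mul_comm _ _
  rw [e1] at h
  nlinarith [h]

end Summit.MatrixMultiplication.MatrixMultiplication.Theorems.RankTwoAdditivity
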